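import Summits.AtomisticToContinuum.HydrodynamicLimit.Theorems.AntiMazurCoboundariesKineticFluxLdDecayVelocityEntropyBudget
import Summits.AtomisticToContinuum.HydrodynamicLimit.Theorems.AntiMazurCoboundariesKineticFluxLdDecayHTheoremObjectsD
import Literature.Probability.Moments.GaussianNormExpMoment
import HarnessLib

/-!
# First velocity moment budget for the crux line `h-theorem-dissipation-budget` (crux `KineticFluxLdDecay`,
# stmt-AtomisticToContinuum-10967) — registered stub `stub_firstMomentBudget` (objects part D)

In the frame of `Theorems/AntiMazurCoboundariesKineticFluxLdDecayHTheoremObjects.lean` (statement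
`HTheorem.FirstMomentBudget` of `…HTheoremObjectsD.lean`): there is an absolute constant `c₀ ≥ 0` such that for
constant profiles `a, θ > 0`, `σ ≤ 1/2`, every probability law `ν` with `KL(ν ‖ G_N) < ∞`, every time `t`, every
flow `Φ` and every `N`, the first velocity moment of the reduced one-body law `f_t` of `ν` is budgeted by the
`N`-body entropy per particle: `∫⁻ ‖w‖ df_t ≤ c₀ + KL(ν ‖ G_N)/(N+1)`.

Proof (Donsker–Varadhan with truncated velocity-normalised tests; no disintegration, no new definitions):

* `Z_∞ = ∫ e^{‖w‖} dγ < ∞` (`γ` the standard Gaussian on `ℝ³`; Fernique, through the tree's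
  `Literature.Probability.Moments.integrable_exp_mul_norm_of_isGaussian`), `c₀ = log Z_∞ ≥ 0`;
* `Z_n = ∫ e^{min(‖w‖, n)} dγ ∈ [1, Z_∞]` and the test function `g_n(x, w) = min(‖w‖, n) − log Z_n`: bounded,
  measurable, `∫ e^{g_n(x, ·)} dγ = 1`;
* the landed one-body Donsker–Varadhan test `integral_oneBodyLaw_le_klDiv` gives
  `(N+1)(∫ min(‖w‖, n) df_t − log Z_n) ≤ KL(ν ‖ G_N)`, whence `∫ min(‖w‖, n) df_t ≤ log Z_∞ + KL/(N+1)`;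
* monotone convergence in `n` (`lintegral_iSup`, `‖w‖ₑ = ⨆ₙ ofReal (min(‖w‖, n))`).

`Z_∞` and `Z_n` are written out as the explicit integrals throughout (this file introduces no definitions).

Reference: C. Kipnis, C. Landim, *Scaling Limits of Interacting Particle Systems* (1999), App. 1 §8
(entropy inequality).
-/

noncomputable section

open MeasureTheory ProbabilityTheory Set Filter InformationTheory
open scoped ENNReal

namespace Summit.AtomisticToContinuum.HydrodynamicLimit.Theorems.HTheorem

open Literature.MathematicalPhysics.KineticTheory (T3 V3)
open Literature.Probability.Moments (integrable_exp_mul_norm_of_isGaussian)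

namespace FirstMoment

/-! ### Gaussian exponential moments of the (truncated) speed

`Z_∞ = ∫ e^{‖w‖} dγ` and `Z_n = ∫ e^{min(‖w‖, n)} dγ`, `γ = stdGaussian ℝ³`. -/

/-- `w ↦ e^{‖w‖}` is `γ`-integrable (Fernique): `Z_∞ < ∞`. -/
theorem integrable_exp_norm : Integrable (fun w : V3 => Real.exp ‖w‖) (stdGaussian V3) := by
  simpa only [one_mul] using integrable_exp_mul_norm_of_isGaussian (stdGaussian V3) 1

/-- `w ↦ e^{min(‖w‖, n)}` is `γ`-integrable (dominated by `e^{‖w‖}`). -/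
theorem integrable_exp_min (n : ℕ) :
    Integrable (fun w : V3 => Real.exp (min ‖w‖ (n : ℝ))) (stdGaussian V3) := by
  refine integrable_exp_norm.mono'
    (by fun_prop : Continuous fun w : V3 => Real.exp (min ‖w‖ (n : ℝ))).aestronglyMeasurable
    (ae_of_all _ fun w => ?_)
  rw [Real.norm_eq_abs, abs_of_pos (Real.exp_pos _)]
  exact Real.exp_le_exp.2 (min_le_left _ _)

/-- `1 ≤ Z_n` (`γ` is a probability measure and `e^{min(‖w‖, n)} ≥ 1`). -/
theorem one_le_zTrunc (n : ℕ) : 1 ≤ ∫ w, Real.exp (min ‖w‖ (n : ℝ)) ∂(stdGaussian V3) := by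
  have h : ∫ _w, (1 : ℝ) ∂(stdGaussian V3) ≤ ∫ w, Real.exp (min ‖w‖ (n : ℝ)) ∂(stdGaussian V3) :=
    integral_mono (integrable_const 1) (integrable_exp_min n) fun w =>
      Real.one_le_exp (le_min (norm_nonneg _) (Nat.cast_nonneg _))
  simpa using h

/-- `Z_n ≤ Z_∞`. -/
theorem zTrunc_le_zInf (n : ℕ) :
    ∫ w, Real.exp (min ‖w‖ (n : ℝ)) ∂(stdGaussian V3) ≤ ∫ w, Real.exp ‖w‖ ∂(stdGaussian V3) :=
  integral_mono (integrable_exp_min n) integrable_exp_norm fun _ =>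
    Real.exp_le_exp.2 (min_le_left _ _)

/-- `1 ≤ Z_∞`. -/
theorem one_le_zInf : 1 ≤ ∫ w, Real.exp ‖w‖ ∂(stdGaussian V3) :=
  (one_le_zTrunc 0).trans (zTrunc_le_zInf 0)

/-- `0 ≤ log Z_n ≤ log Z_∞`. -/
theorem log_zTrunc_mem (n : ℕ) :
    0 ≤ Real.log (∫ w, Real.exp (min ‖w‖ (n : ℝ)) ∂(stdGaussian V3)) ∧
      Real.log (∫ w, Real.exp (min ‖w‖ (n : ℝ)) ∂(stdGaussian V3)) ≤
        Real.log (∫ w, Real.exp ‖w‖ ∂(stdGaussian V3)) :=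
  ⟨Real.log_nonneg (one_le_zTrunc n),
    Real.log_le_log (by linarith [one_le_zTrunc n]) (zTrunc_le_zInf n)⟩

/-! ### The truncated velocity-normalised one-body tests `g_n(x, w) = min(‖w‖, n) − log Z_n` -/

/-- `g_n` is measurable. -/
theorem measurable_test (n : ℕ) :
    Measurable fun p : T3 × V3 =>
      min ‖p.2‖ (n : ℝ) - Real.log (∫ w, Real.exp (min ‖w‖ (n : ℝ)) ∂(stdGaussian V3)) := by
  fun_prop

/-- `|g_n| ≤ n + log Z_∞`. -/
theorem abs_test_le (n : ℕ) (p : T3 × V3) :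
    |min ‖p.2‖ (n : ℝ) - Real.log (∫ w, Real.exp (min ‖w‖ (n : ℝ)) ∂(stdGaussian V3))| ≤
      n + Real.log (∫ w, Real.exp ‖w‖ ∂(stdGaussian V3)) := by
  obtain ⟨h0, h1⟩ := log_zTrunc_mem n
  have h2 : 0 ≤ min ‖p.2‖ (n : ℝ) := le_min (norm_nonneg _) (Nat.cast_nonneg _)
  have h3 : min ‖p.2‖ (n : ℝ) ≤ n := min_le_right _ _
  rw [abs_le]
  constructor <;> linarith

/-- `g_n` is velocity-normalised: `∫ e^{g_n(x, w)} γ(dw) = Z_n / Z_n = 1`. -/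
theorem integral_exp_test (n : ℕ) :
    ∫ w, Real.exp (min ‖w‖ (n : ℝ) - Real.log (∫ w', Real.exp (min ‖w'‖ (n : ℝ)) ∂(stdGaussian V3)))
      ∂(stdGaussian V3) = 1 := by
  have hZ : 0 < ∫ w', Real.exp (min ‖w'‖ (n : ℝ)) ∂(stdGaussian V3) := by linarith [one_le_zTrunc n]
  simp_rw [Real.exp_sub, Real.exp_log hZ, integral_div]
  exact div_self hZ.ne'

/-- `min(‖w‖, n)` is integrable against every finite one-body law. -/
theorem integrable_min_norm (n : ℕ) (μ : Measure (T3 × V3)) [IsFiniteMeasure μ] :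
    Integrable (fun p : T3 × V3 => min ‖p.2‖ (n : ℝ)) μ :=
  Integrable.of_bound (by fun_prop : Measurable fun p : T3 × V3 => min ‖p.2‖ (n : ℝ)).aestronglyMeasurable
    n (ae_of_all _ fun p => by
      rw [Real.norm_eq_abs, abs_of_nonneg (le_min (norm_nonneg _) (Nat.cast_nonneg _))]
      exact min_le_right _ _)

/-- **Truncated first moment budget**: `∫ min(‖w‖, n) df_t ≤ log Z_∞ + KL(ν ‖ G_N)/(N+1)` for every `n`
(the one-body Donsker–Varadhan test `integral_oneBodyLaw_le_klDiv` with `g_n`). -/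
theorem integral_min_norm_le {σ a θ : ℝ} (ha : 0 < a) (hθ : 0 < θ) (hσ : σ ≤ 1 / 2) (u₀ : V3)
    (N : ℕ) (Φ : Flow σ N) (ν : Measure (Phase N)) [IsProbabilityMeasure ν]
    (hfin : klDiv ν (gibbs σ a θ u₀ N Φ) ≠ ⊤) (t : ℝ) (n : ℕ) :
    ∫ p, min ‖p.2‖ (n : ℝ) ∂(oneBodyLaw θ u₀ Φ ν t) ≤
      Real.log (∫ w, Real.exp ‖w‖ ∂(stdGaussian V3)) +
        (klDiv ν (gibbs σ a θ u₀ N Φ)).toReal / ((N + 1 : ℕ) : ℝ) := by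
  haveI := isProbabilityMeasure_oneBodyLaw (Nat.succ_ne_zero N) θ u₀ Φ ν t
  have hn : (0 : ℝ) < ((N + 1 : ℕ) : ℝ) := Nat.cast_pos.2 (Nat.succ_pos N)
  have h := integral_oneBodyLaw_le_klDiv ha hθ hσ u₀ N Φ ν hfin t (measurable_test n) (abs_test_le n)
    fun _ => integral_exp_test n
  rw [integral_sub (integrable_min_norm n _) (integrable_const _), integral_const, probReal_univ,
    one_smul] at h
  have h' : ∫ p, min ‖p.2‖ (n : ℝ) ∂(oneBodyLaw θ u₀ Φ ν t) -
      Real.log (∫ w, Real.exp (min ‖w‖ (n : ℝ)) ∂(stdGaussian V3)) ≤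
        (klDiv ν (gibbs σ a θ u₀ N Φ)).toReal / ((N + 1 : ℕ) : ℝ) := by
    rw [le_div_iff₀ hn, mul_comm]
    exact h
  linarith [(log_zTrunc_mem n).2]

/-- Monotone truncation of the extended norm: `‖w‖ₑ = ⨆ₙ ofReal (min(‖w‖, n))`. -/
theorem enorm_eq_iSup_min (w : V3) : ‖w‖ₑ = ⨆ n : ℕ, ENNReal.ofReal (min ‖w‖ (n : ℝ)) := by
  refine le_antisymm ?_ (iSup_le fun n => ?_)
  · obtain ⟨n, hn⟩ := exists_nat_ge ‖w‖
    refine le_iSup_of_le n ?_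
    rw [min_eq_left hn, ofReal_norm]
  · rw [← ofReal_norm]
    exact ENNReal.ofReal_le_ofReal (min_le_left _ _)

/-- **First moment budget with the explicit constant `c₀ = log Z_∞`**:
`∫⁻ ‖w‖ df_t ≤ ofReal (log Z_∞ + KL(ν ‖ G_N)/(N+1))` (monotone convergence over the truncations). -/
theorem lintegral_enorm_le {σ a θ : ℝ} (ha : 0 < a) (hθ : 0 < θ) (hσ : σ ≤ 1 / 2) (u₀ : V3)
    (N : ℕ) (Φ : Flow σ N) (ν : Measure (Phase N)) [IsProbabilityMeasure ν]
    (hfin : klDiv ν (gibbs σ a θ u₀ N Φ) ≠ ⊤) (t : ℝ) :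
    ∫⁻ y, ‖y.2‖ₑ ∂(oneBodyLaw θ u₀ Φ ν t) ≤
      ENNReal.ofReal (Real.log (∫ w, Real.exp ‖w‖ ∂(stdGaussian V3)) +
        (klDiv ν (gibbs σ a θ u₀ N Φ)).toReal / ((N + 1 : ℕ) : ℝ)) := by
  haveI := isProbabilityMeasure_oneBodyLaw (Nat.succ_ne_zero N) θ u₀ Φ ν t
  have hmeas : ∀ n : ℕ, Measurable fun y : T3 × V3 => ENNReal.ofReal (min ‖y.2‖ (n : ℝ)) := fun n => by
    fun_prop
  have hmono : Monotone fun (n : ℕ) (y : T3 × V3) => ENNReal.ofReal (min ‖y.2‖ (n : ℝ)) := by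
    intro m n hmn y
    exact ENNReal.ofReal_le_ofReal (min_le_min_left _ (Nat.cast_le.2 hmn))
  calc ∫⁻ y, ‖y.2‖ₑ ∂(oneBodyLaw θ u₀ Φ ν t)
      = ∫⁻ y, ⨆ n : ℕ, ENNReal.ofReal (min ‖y.2‖ (n : ℝ)) ∂(oneBodyLaw θ u₀ Φ ν t) :=
        lintegral_congr fun y => enorm_eq_iSup_min y.2
    _ = ⨆ n : ℕ, ∫⁻ y, ENNReal.ofReal (min ‖y.2‖ (n : ℝ)) ∂(oneBodyLaw θ u₀ Φ ν t) :=
        lintegral_iSup hmeas hmono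
    _ ≤ _ := iSup_le fun n => ?_
  rw [← ofReal_integral_eq_lintegral_ofReal (integrable_min_norm n _)
    (ae_of_all _ fun y => le_min (norm_nonneg _) (Nat.cast_nonneg _))]
  exact ENNReal.ofReal_le_ofReal (integral_min_norm_le ha hθ hσ u₀ N Φ ν hfin t n)

end FirstMoment

/-! ### The registered stub -/

/-- **First moment budget, explicit form**: with `c₀ = log ∫ e^{‖w‖} dγ ≥ 0`, for constant profiles
`a, θ > 0`, `σ ≤ 1/2`, every probability law `ν` with `KL(ν ‖ G_N) < ∞`, every time, flow and `N`:
`∫⁻ ‖w‖ df_t ≤ ofReal (c₀ + KL(ν ‖ G_N)/(N+1))`. -/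
theorem firstMomentBudget_explicit :
    ∃ c₀ : ℝ, 0 ≤ c₀ ∧ ∀ (σ a θ : ℝ) (u₀ : V3) (N : ℕ) (Φ : Flow σ N) (ν : Measure (Phase N)),
      IsProbabilityMeasure ν → 0 < a → 0 < θ → σ ≤ 1 / 2 →
      klDiv ν (gibbs σ a θ u₀ N Φ) ≠ ⊤ → ∀ t : ℝ,
        ∫⁻ y, ‖y.2‖ₑ ∂(oneBodyLaw θ u₀ Φ ν t) ≤
          ENNReal.ofReal (c₀ + (klDiv ν (gibbs σ a θ u₀ N Φ)).toReal / ((N + 1 : ℕ) : ℝ)) :=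
  ⟨Real.log (∫ w, Real.exp ‖w‖ ∂(stdGaussian V3)), Real.log_nonneg FirstMoment.one_le_zInf,
    fun _σ _a _θ u₀ N Φ ν _ ha hθ hσ hfin t =>
      FirstMoment.lintegral_enorm_le ha hθ hσ u₀ N Φ ν hfin t⟩

/-- **First moment budget** (registered stub `stub_firstMomentBudget` of the line
`h-theorem-dissipation-budget`, objects part D): finite relative entropy w.r.t. the Gibbs law budgets the first
velocity moment of the reduced one-body law, uniformly in the time, the flow and `N`:
`∫⁻ ‖w‖ df_t ≤ c₀ + KL(ν ‖ G_N)/(N+1)` with the absolute constant `c₀ = log ∫ e^{‖w‖} dγ`. -/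
theorem stub_firstMomentBudget : FirstMomentBudget := firstMomentBudget_explicit

end Summit.AtomisticToContinuum.HydrodynamicLimit.Theorems.HTheorem

end
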